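import Literature.Probability.RandomPlanarGeometry.SLEImageLocalMartingale
import Literature.Probability.Process.StoppedMartingale
import HarnessLib

/-!
# The localised image driving function of SLE₆ is a martingale, II: summation ([LSW 2001] Thm. 2.2)

Sequel of `SLEImageLocalMartingale` (G. F. Lawler, O. Schramm, W. Werner, Acta Math. **187** (2001),
Thm. 2.2; [LSW] 2003 §5, remark after (5.1): at `κ = 6` the image driving value `W̃_t = h_t(W_t)` is a
continuous local martingale). Summing the cell estimate `abs_setIntegral_imgCell_le` over a uniform
partition of `[s, t]` (`abs_setIntegral_imgMartK_sub_le_of_partition`: the boundary events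
`{u_i < T < u_{i+1}}` are pairwise disjoint), letting the mesh go to `0` and then the oscillation
threshold `κ₀ → 0` gives `∫_S (Mⁿ_t − Mⁿ_s) = 0` for `S ∈ 𝓕_s` (`setIntegral_imgMartK_sub_eq_zero`), whence
**`Mⁿ = imgMartK 6 hA hne n` (the image driving function `W̃` of SLE₆ under the `*`-hull `A`, stopped at
the localising time) is a bounded `𝓕`-martingale of the driving Brownian motion** (`martingale_imgMartK`,
`isAEMartingale_imgMartK`).

## References

* G. F. Lawler, O. Schramm, W. Werner, Acta Math. **187** (2001), Thm. 2.2. [LawlerSchrammWerner2001]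
* [LSW] 2003, §5 (remark after (5.1)). [LawlerSchrammWerner2003Restriction]
-/

noncomputable section

open Set Filter Metric Function MeasureTheory ProbabilityTheory
open _root_.Complex _root_.Topology
open Literature.Probability.Process (brownian preWienerMeasure runSup)
open scoped NNReal

namespace Literature.Probability.RandomPlanarGeometry

open Loewner PathOps

variable {A : Set ℂ} {hA : IsStarHull A} {hne : A.Nonempty} {n : ℕ}

/-! ### Telescoping over a partition -/

section Partition

variable [MeasurableSpace C(ℝ≥0, ℝ)] [BorelSpace C(ℝ≥0, ℝ)]

/-- **Summing the cell estimates over a uniform partition of `[s, t]` into `N` cells of length `h`**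
(`t ≤ t₁`, the horizon of the one-step constant `C`). [folklore] -/
theorem abs_setIntegral_imgMartK_sub_le_of_partition (hA : IsStarHull A) (hne : A.Nonempty) {R : ℝ} (hR0 : 0 < R)
    (hAR : A ⊆ closedBall (0 : ℂ) R) {t₁ : ℝ≥0} {C : ℝ}
    (hC : ∀ (u h : ℝ≥0), u ≤ t₁ → 0 < h → 192 * (h : ℝ) ≤ (locLevel n * (locLevel n / 8) / 4000) ^ 2 →
      ∀ {g : (ℝ≥0 → ℝ) → ℝ}, Measurable[brownianFiltration u] g → (∀ ω, g ω ∈ Icc (0 : ℝ) 1) →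
        (∀ ω, g ω ≠ 0 → Disjoint (closedHull (drvK 6 (brownianCPath ω)) u) A ∧
          Disjoint (ball (0 : ℂ) (8 * (locLevel n / 8))) (slidHull (drvK 6 (brownianCPath ω)) A u) ∧
            locLevel n ≤ starDeriv (slidHull (drvK 6 (brownianCPath ω)) A u)) →
        |∫ ω, g ω * (imageDrvFnK 6 A (u + h) (brownianCPath ω) - imageDrvFnK 6 A u (brownianCPath ω)) ∂preWienerMeasure| ≤
          C * h * Real.sqrt h)
    {s t : ℝ≥0} (hst : s ≤ t) (ht₁ : t ≤ t₁) {S : Set (ℝ≥0 → ℝ)} (hS : MeasurableSet[brownianFiltration s] S)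
    {κ₀ : ℝ} (hκ₀ : 0 < κ₀) {N : ℕ} {h : ℝ≥0} (hhN : (N : ℝ≥0) * h = t - s) (hh0 : 0 < h) (hh1 : (h : ℝ) ≤ 1)
    (hhc : 192 * (h : ℝ) ≤ (locLevel n * (locLevel n / 8) / 4000) ^ 2)
    (hh2 : stepSize κ₀ h ≤ locLevel n * (locLevel n / 16) / 1000)
    (hh4 : (h : ℝ) ≤ (κ₀ / Real.sqrt 6 / 2) ^ 2 / 2) :
    |∫ ω in S, (imgMartK 6 hA hne n t ω - imgMartK 6 hA hne n s ω) ∂preWienerMeasure| ≤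
      N * (C * h * Real.sqrt h) + (50 * h / (locLevel n / 16) + 4 * κ₀) +
        N * (((2 * (((n : ℝ) + 1) + 1160 * (3 * ((n : ℝ) + 1) + 13 * Real.sqrt ((n : ℝ) + 1) + R)) +
            (15080 * Real.sqrt ((t₁ : ℝ) + 1) + 1160 * R) + 3482 * Real.sqrt 6) * (4608 / κ₀ ^ 4) +
          3482 * Real.sqrt 6 * (18 * ((t₁ : ℝ) + 1) ^ 2)) * h * Real.sqrt h) := by
  haveI := isProbabilityMeasure_preWienerMeasure'
  have hc0 := (locLevel_pos_le n).1
  have hSm : MeasurableSet S := brownianFiltration.le s _ hS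
  set M := imgMartK 6 hA hne n with hM
  set K : ℝ := ((2 * (((n : ℝ) + 1) + 1160 * (3 * ((n : ℝ) + 1) + 13 * Real.sqrt ((n : ℝ) + 1) + R)) +
      (15080 * Real.sqrt ((t₁ : ℝ) + 1) + 1160 * R) + 3482 * Real.sqrt 6) * (4608 / κ₀ ^ 4) +
    3482 * Real.sqrt 6 * (18 * ((t₁ : ℝ) + 1) ^ 2)) with hK
  set D : ℝ := 50 * h / (locLevel n / 16) + 4 * κ₀ with hD
  have hD0 : 0 ≤ D := by positivity
  set u : ℕ → ℝ≥0 := fun i ↦ s + (i : ℝ≥0) * h with hu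
  have hu0 : u 0 = s := by simp [hu]
  have huN : u N = t := by rw [hu]; simp only; rw [hhN, add_tsub_cancel_of_le hst]
  have husucc : ∀ i, u (i + 1) = u i + h := fun i ↦ by simp only [hu]; push_cast; ring
  have hsu : ∀ i, s ≤ u i := fun i ↦ by simp only [hu]; exact le_self_add
  have hut : ∀ i, i < N → u i ≤ t₁ := fun i hi ↦ by
    refine le_trans ?_ ht₁
    rw [← huN]; simp only [hu]
    gcongr
  -- telescoping
  have hint : ∀ i, Integrable (M (u i)) preWienerMeasure := fun i ↦ integrable_imgMartK n _
  have htel : ∫ ω in S, (M t ω - M s ω) ∂preWienerMeasure =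
      ∑ i ∈ Finset.range N, ∫ ω in S, (M (u (i + 1)) ω - M (u i) ω) ∂preWienerMeasure := by
    have e1 : (fun ω ↦ M t ω - M s ω) = fun ω ↦ ∑ i ∈ Finset.range N, (M (u (i + 1)) ω - M (u i) ω) := by
      funext ω; rw [Finset.sum_range_sub (fun i ↦ M (u i) ω), huN, hu0]
    have hint' : ∀ i ∈ Finset.range N, Integrable (fun ω ↦ M (u (i + 1)) ω - M (u i) ω) (preWienerMeasure.restrict S) :=
      fun i _ ↦ ((hint (i + 1)).sub (hint i)).integrableOn
    rw [e1]
    exact integral_finsetSum (Finset.range N) (f := fun i ω ↦ M (u (i + 1)) ω - M (u i) ω) hint'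
  rw [htel]
  -- the boundary events are pairwise disjoint
  set E : ℕ → Set (ℝ≥0 → ℝ) := fun i ↦ {ω | ((u i : ℝ≥0) : WithTop ℝ≥0) < imgLocTimeK 6 hA hne n ω ∧
    imgLocTimeK 6 hA hne n ω < ((u i + h : ℝ≥0) : WithTop ℝ≥0)} with hE
  have hEm : ∀ i, MeasurableSet (E i) := fun i ↦ by
    obtain ⟨-, h1, h2⟩ := measurableSet_lt_imgLocTimeK (κ := 6) (hA := hA) (hne := hne) n (u i) (u i + h)
    exact h1.inter h2
  have hdisj : Set.PairwiseDisjoint (↑(Finset.range N) : Set ℕ) E := by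
    intro i _ j _ hij
    rw [Function.onFun, Set.disjoint_left]
    rintro ω ⟨hi1, hi2⟩ ⟨hj1, hj2⟩
    have hh0' : (0 : ℝ) < h := hh0
    have hji : u j < u i + h := by have := hj1.trans hi2; exact_mod_cast this
    have hij' : u i < u j + h := by have := hi1.trans hj2; exact_mod_cast this
    have hji_r : (s : ℝ) + j * h < s + i * h + h := by have := hji; simp only [hu] at this; exact_mod_cast this
    have hij_r : (s : ℝ) + i * h < s + j * h + h := by have := hij'; simp only [hu] at this; exact_mod_cast this
    rcases lt_or_gt_of_ne hij with hlt | hlt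
    · have : (i : ℝ) + 1 ≤ j := by exact_mod_cast hlt
      nlinarith
    · have : (j : ℝ) + 1 ≤ i := by exact_mod_cast hlt
      nlinarith
  have hsumE : ∑ i ∈ Finset.range N, preWienerMeasure.real (E i) ≤ 1 := by
    have := sum_measureReal_le_measureReal_univ (μ := preWienerMeasure) (s := Finset.range N) (fun i _ ↦ hEm i) hdisj
    rwa [probReal_univ] at this
  -- sum the cell estimates
  have hcell : ∀ i ∈ Finset.range N, |∫ ω in S, (M (u (i + 1)) ω - M (u i) ω) ∂preWienerMeasure| ≤
      C * h * Real.sqrt h + D * preWienerMeasure.real (E i) + K * h * Real.sqrt h := fun i hi ↦ by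
    rw [husucc]
    exact abs_setIntegral_imgCell_le hA hne hR0 hAR hC (hsu i) (hut i (Finset.mem_range.1 hi)) hS hκ₀ hh0 hh1 hhc hh2 hh4
  calc |∑ i ∈ Finset.range N, ∫ ω in S, (M (u (i + 1)) ω - M (u i) ω) ∂preWienerMeasure|
      ≤ ∑ i ∈ Finset.range N, |∫ ω in S, (M (u (i + 1)) ω - M (u i) ω) ∂preWienerMeasure| := Finset.abs_sum_le_sum_abs _ _
    _ ≤ ∑ i ∈ Finset.range N, (C * h * Real.sqrt h + D * preWienerMeasure.real (E i) + K * h * Real.sqrt h) := Finset.sum_le_sum hcell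
    _ = N * (C * h * Real.sqrt h) + D * ∑ i ∈ Finset.range N, preWienerMeasure.real (E i) + N * (K * h * Real.sqrt h) := by
        rw [Finset.sum_add_distrib, Finset.sum_add_distrib, Finset.sum_const, Finset.sum_const, Finset.card_range, ← Finset.mul_sum]
        simp [nsmul_eq_mul]
    _ ≤ _ := by
        have := mul_le_mul_of_nonneg_left hsumE hD0
        linarith

end Partition

/-! ### The increments of `Mⁿ` integrate to zero over `𝓕_s`-events -/

section Zero

/-- **`∫_S (Mⁿ_t − Mⁿ_s) = 0` for `s ≤ t` and `S ∈ 𝓕_s`**: let the mesh of the partition go to `0` (the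
sum of the cell bounds tends to `4κ₀`), then the oscillation threshold `κ₀ → 0`.
[cite: LawlerSchrammWerner2001, Thm. 2.2] -/
theorem setIntegral_imgMartK_sub_eq_zero {s t : ℝ≥0} (hst : s ≤ t) {S : Set (ℝ≥0 → ℝ)}
    (hS : MeasurableSet[brownianFiltration s] S) :
    ∫ ω in S, (imgMartK 6 hA hne n t ω - imgMartK 6 hA hne n s ω) ∂preWienerMeasure = 0 := by
  letI : MeasurableSpace C(ℝ≥0, ℝ) := borel _
  haveI : BorelSpace C(ℝ≥0, ℝ) := ⟨rfl⟩
  rcases hst.eq_or_lt with heq | hst'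
  · subst heq; simp
  obtain ⟨hc0, hc1⟩ := locLevel_pos_le n
  set c := locLevel n with hc
  -- the radius of `A` and the one-step constant at horizon `t`
  obtain ⟨R₁, hR₁⟩ := hA.isBoundedHull.isCompact.isBounded.subset_closedBall (0 : ℂ)
  set R : ℝ := max R₁ 1 with hR
  have hR0 : 0 < R := lt_max_of_lt_right one_pos
  have hAR : A ⊆ closedBall (0 : ℂ) R := hR₁.trans (closedBall_subset_closedBall (le_max_left _ _))
  have hρ₀ : 0 < c / 8 := by positivity
  have hρ1 : c / 8 ≤ 1 := by linarith
  obtain ⟨C, hC0, hC⟩ := exists_abs_integral_mul_imageDrv_sub_le hA hne hρ₀ hρ1 hc0 hc1 (measurable_imageDrvFnK 6 hA hne) t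
  have hC' : ∀ (u h : ℝ≥0), u ≤ t → 0 < h → 192 * (h : ℝ) ≤ (c * (c / 8) / 4000) ^ 2 →
      ∀ {g : (ℝ≥0 → ℝ) → ℝ}, Measurable[brownianFiltration u] g → (∀ ω, g ω ∈ Icc (0 : ℝ) 1) →
        (∀ ω, g ω ≠ 0 → Disjoint (closedHull (drvK 6 (brownianCPath ω)) u) A ∧
          Disjoint (ball (0 : ℂ) (8 * (c / 8))) (slidHull (drvK 6 (brownianCPath ω)) A u) ∧
            c ≤ starDeriv (slidHull (drvK 6 (brownianCPath ω)) A u)) →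
        |∫ ω, g ω * (imageDrvFnK 6 A (u + h) (brownianCPath ω) - imageDrvFnK 6 A u (brownianCPath ω)) ∂preWienerMeasure| ≤
          C * h * Real.sqrt h :=
    fun u h hu hh0 hh g hgm hg01 hsupp ↦ (hC u h hu hh0 hh hgm hg01 hsupp).1
  set I : ℝ := ∫ ω in S, (imgMartK 6 hA hne n t ω - imgMartK 6 hA hne n s ω) ∂preWienerMeasure with hI
  have hts : (0 : ℝ) < (t : ℝ) - s := by have : (s : ℝ) < t := (by exact_mod_cast hst'); linarith
  -- the mesh `h_N = (t - s)/(N + 1)` and its limits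
  set hN : ℕ → ℝ≥0 := fun N ↦ (t - s) / ((N : ℝ≥0) + 1) with hhN
  have hhN' : ∀ N : ℕ, (((N + 1 : ℕ) : ℝ≥0)) * hN N = t - s := fun N ↦ by
    simp only [hhN]; push_cast; rw [mul_div_cancel₀ _ (by positivity)]
  have hcoe : ∀ N : ℕ, (hN N : ℝ) = ((t : ℝ) - s) / ((N : ℝ) + 1) := fun N ↦ by
    simp only [hhN]; push_cast [NNReal.coe_sub hst]; ring
  have hh_pos : ∀ N, 0 < hN N := fun N ↦ by
    have : (0 : ℝ) < hN N := by rw [hcoe]; positivity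
    exact_mod_cast this
  have hh_tend : Tendsto (fun N ↦ (hN N : ℝ)) atTop (𝓝 0) := by
    simp_rw [hcoe]
    exact tendsto_const_nhds.div_atTop (tendsto_natCast_atTop_atTop.atTop_add tendsto_const_nhds)
  have hsqrt_tend : Tendsto (fun N ↦ Real.sqrt (hN N)) atTop (𝓝 0) := by
    have := (Real.continuous_sqrt.tendsto 0).comp hh_tend
    rwa [Function.comp_def, Real.sqrt_zero] at this
  have hNh : ∀ N : ℕ, ((N + 1 : ℕ) : ℝ) * (hN N : ℝ) = (t : ℝ) - s := fun N ↦ by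
    rw [hcoe]; push_cast; field_simp
  -- Step 1: for every small `κ₀ > 0`, `|I| ≤ 4κ₀`
  have step1 : ∀ κ₀ : ℝ, 0 < κ₀ → κ₀ ≤ c * (c / 16) / 2000 → |I| ≤ 4 * κ₀ := by
    intro κ₀ hκ₀ hκc
    set K : ℝ := ((2 * (((n : ℝ) + 1) + 1160 * (3 * ((n : ℝ) + 1) + 13 * Real.sqrt ((n : ℝ) + 1) + R)) +
        (15080 * Real.sqrt ((t : ℝ) + 1) + 1160 * R) + 3482 * Real.sqrt 6) * (4608 / κ₀ ^ 4) +
      3482 * Real.sqrt 6 * (18 * ((t : ℝ) + 1) ^ 2)) with hK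
    set RHS : ℕ → ℝ := fun N ↦ ((N + 1 : ℕ) : ℝ) * (C * hN N * Real.sqrt (hN N)) +
        (50 * hN N / (c / 16) + 4 * κ₀) + ((N + 1 : ℕ) : ℝ) * (K * hN N * Real.sqrt (hN N)) with hRHS
    have hRHS_eq : ∀ N, RHS N = C * ((t : ℝ) - s) * Real.sqrt (hN N) + (50 * hN N / (c / 16) + 4 * κ₀) +
        K * ((t : ℝ) - s) * Real.sqrt (hN N) := fun N ↦ by
      simp only [hRHS]
      have e := hNh N
      have e1 : ((N + 1 : ℕ) : ℝ) * (C * hN N * Real.sqrt (hN N)) = C * (((N + 1 : ℕ) : ℝ) * hN N) * Real.sqrt (hN N) := by ring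
      have e2 : ((N + 1 : ℕ) : ℝ) * (K * hN N * Real.sqrt (hN N)) = K * (((N + 1 : ℕ) : ℝ) * hN N) * Real.sqrt (hN N) := by ring
      rw [e1, e2, e]
    have hlim : Tendsto RHS atTop (𝓝 (4 * κ₀)) := by
      have h1 : Tendsto (fun N ↦ C * ((t : ℝ) - s) * Real.sqrt (hN N)) atTop (𝓝 0) := by
        have := tendsto_const_nhds (x := C * ((t : ℝ) - s)) |>.mul hsqrt_tend
        rwa [mul_zero] at this
      have h2 : Tendsto (fun N ↦ 50 * (hN N : ℝ) / (c / 16) + 4 * κ₀) atTop (𝓝 (50 * 0 / (c / 16) + 4 * κ₀)) :=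
        ((tendsto_const_nhds.mul hh_tend).div_const _).add tendsto_const_nhds
      rw [mul_zero, zero_div, zero_add] at h2
      have h3 : Tendsto (fun N ↦ K * ((t : ℝ) - s) * Real.sqrt (hN N)) atTop (𝓝 0) := by
        have := tendsto_const_nhds (x := K * ((t : ℝ) - s)) |>.mul hsqrt_tend
        rwa [mul_zero] at this
      have := (h1.add h2).add h3
      rw [zero_add, add_zero] at this
      exact this.congr fun N ↦ (hRHS_eq N).symm
    -- eventually all smallness conditions hold, and then `|I| ≤ RHS N`
    have hK1 : (0 : ℝ) < (c * (c / 8) / 4000) ^ 2 / 192 := by positivity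
    have hK4 : (0 : ℝ) < (κ₀ / Real.sqrt 6 / 2) ^ 2 / 2 := by
      have : 0 < κ₀ / Real.sqrt 6 := div_pos hκ₀ (Real.sqrt_pos.2 (by norm_num)); positivity
    have hK2 : (0 : ℝ) < c * (c / 16) / 8000 := by positivity
    have hev : ∀ᶠ N in atTop, |I| ≤ RHS N := by
      filter_upwards [hh_tend.eventually (eventually_le_nhds hK1), hh_tend.eventually (eventually_le_nhds hK4),
        hh_tend.eventually (eventually_le_nhds one_pos), hsqrt_tend.eventually (eventually_le_nhds hK2)] with N h1 h4 h1' h2b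
      have hhc : 192 * (hN N : ℝ) ≤ (c * (c / 8) / 4000) ^ 2 := by
        have := mul_le_mul_of_nonneg_left h1 (by norm_num : (0 : ℝ) ≤ 192)
        rwa [mul_div_cancel₀ _ (by norm_num : (192 : ℝ) ≠ 0)] at this
      have hh2 : stepSize κ₀ (hN N) ≤ c * (c / 16) / 1000 := by rw [stepSize]; linarith
      exact abs_setIntegral_imgMartK_sub_le_of_partition (n := n) hA hne hR0 hAR hC' hst le_rfl hS hκ₀ (N := N + 1) (hhN' N)
        (hh_pos N) h1' hhc hh2 h4
    exact ge_of_tendsto hlim hev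
  -- Step 2: `κ₀ → 0`
  have hL : Tendsto (fun κ₀ : ℝ ↦ 4 * κ₀) (𝓝[>] 0) (𝓝 0) := by
    have h1 : Tendsto (fun κ₀ : ℝ ↦ 4 * κ₀) (𝓝 0) (𝓝 (4 * 0)) := tendsto_const_nhds.mul tendsto_id
    rw [mul_zero] at h1
    exact h1.mono_left nhdsWithin_le_nhds
  have hevκ : ∀ᶠ κ₀ in 𝓝[>] (0 : ℝ), |I| ≤ 4 * κ₀ := by
    have hpos : ∀ᶠ κ₀ in 𝓝[>] (0 : ℝ), 0 < κ₀ := eventually_mem_nhdsWithin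
    have hsmall : ∀ᶠ κ₀ in 𝓝[>] (0 : ℝ), κ₀ ≤ c * (c / 16) / 2000 :=
      (eventually_le_nhds (by positivity : (0 : ℝ) < c * (c / 16) / 2000)).filter_mono nhdsWithin_le_nhds
    filter_upwards [hpos, hsmall] with κ₀ h1 h2
    exact step1 κ₀ h1 h2
  exact abs_nonpos_iff.1 (ge_of_tendsto hL hevκ)

end Zero

/-! ### The martingale -/

section Mart

/-- **[LSW 2001] Thm. 2.2 (locality of SLE₆), local-martingale content**: for every nonempty `*`-hull `A`
and `n`, the image driving function `W̃_t = h_t(W_t) = W_t + L_A − L_{B_t}` of SLE₆ stopped at the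
localising time `imgLocTimeK n` (`imgMartK 6 hA hne n`) is a bounded `𝓕`-martingale of the driving
Brownian motion. [cite: LawlerSchrammWerner2001, Thm. 2.2] -/
theorem martingale_imgMartK : Martingale (imgMartK 6 hA hne n) brownianFiltration preWienerMeasure := by
  letI : MeasurableSpace C(ℝ≥0, ℝ) := borel _
  haveI : BorelSpace C(ℝ≥0, ℝ) := ⟨rfl⟩
  haveI := isProbabilityMeasure_preWienerMeasure'
  refine ⟨stronglyAdapted_imgMartK n, fun i j hij ↦ ?_⟩
  have hm : brownianFiltration i ≤ (inferInstance : MeasurableSpace (ℝ≥0 → ℝ)) := brownianFiltration.le i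
  haveI : IsFiniteMeasure (preWienerMeasure.trim hm) := isFiniteMeasure_trim hm
  refine (ae_eq_condExp_of_forall_setIntegral_eq hm (integrable_imgMartK n j)
    (fun S _ _ ↦ (integrable_imgMartK n i).integrableOn) (fun S hS _ ↦ ?_)
    (((stronglyAdapted_imgMartK n) i).aestronglyMeasurable)).symm
  have h0 := setIntegral_imgMartK_sub_eq_zero (hA := hA) (hne := hne) (n := n) hij hS
  rw [integral_sub (integrable_imgMartK n j).integrableOn (integrable_imgMartK n i).integrableOn, sub_eq_zero] at h0
  exact h0.symm

/-- `Mⁿ` is an a.e. martingale (the form consumed by `HasMartingaleClock`). [folklore] -/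
theorem isAEMartingale_imgMartK : Process.IsAEMartingale (imgMartK 6 hA hne n) brownianFiltration preWienerMeasure :=
  martingale_imgMartK.isAEMartingale

end Mart

end Literature.Probability.RandomPlanarGeometry

end
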